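import Summits.BirchSwinnertonDyer.BirchSwinnertonDyer.Theorems.SchneiderFreeAdditiveX3CanonicalLinePotMult
import Summits.BirchSwinnertonDyer.BirchSwinnertonDyer.Theorems.SchneiderFreeAdditiveX3ControlGlobalPTorsionF
import Summits.BirchSwinnertonDyer.BirchSwinnertonDyer.Theorems.SchneiderFreeAdditiveX3PotMultBranchIMCRetype
import Summits.BirchSwinnertonDyer.BirchSwinnertonDyer.Theorems.SchneiderFreeAdditiveX3BranchIMCHalves
import HarnessLib

/-!
# Crux r2 `PotMultBranchIMC` (stmt-BirchSwinnertonDyer-19176): the control corner ELIMINATED on the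
# (M) cell — T-B6-2′ and the registered stub `stub_charTorsion` from published facts, and the crux
# ⟺ its pure-divisibility half modulo published facts only

Seat `bsd-schneider-door-c2` (cell `bsd-schneider-ideate`), gen 5; route `SchneiderFreeAdditiveX3`; sequel
of `…CanonicalLinePotMult`.  Gen 4's re-typing record (`…PotMultBranchIMCRetype`) placed crux r2 as
"⟺ its pure-divisibility half MODULO Kolyvagin + the control crux r4".  With Fin_v on the (M) cell now
a theorem from the CFT fact (i) and A41 (`lineCharacter_subM`, `localTowerTorsionFiniteAt_of_lineCharacter`)
and door-c4 gen 3's frame-level control `additiveControlOnTreeAt_anyTorsion_of_facts`, the control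
corner is no longer an input on the (M) cell:

* `additiveControlOnTreeAt_subM_of_facts` — **T-B6-2′ (`SchneiderFree.AdditiveControlOnTreeAt`) at
  EVERY (M) frame of the door from the seven published facts** {Poitou–Tate for Selmer structures,
  Poitou–Tate for Ш, Brink Thm. 2, Brink Cor. 1, Kolyvagin (GZK), the CFT norm-residue fact (i), Tate's
  uniformisation A41};
* `stub_charTorsion_of_facts` — the REGISTERED stub `stub_charTorsion` of the skeleton v3 «typed
  halves» of crux r2 (signature verbatim), from the same facts (gen 0 had it only ⇐ crux r4);
* `potMultBranchIMC_of_facts_of_divisibilityLe` / `potMultBranchIMC_iff_divisibilityLe_of_facts` —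
  **crux r2 ⟺ the registered stub `stub_divisibilityLe` (its pure-divisibility half
  `2·ord_p log_ω P ≤ ord_p f_ac(0) + 2·v_p(c)`) modulo the seven published facts ONLY.**

So on the (M) cell the door's open content is EXACTLY the typed halves H1|M/H2|M/H3|M (BDP frame, value,
branch main conjecture ⊇ — none in print); every other input is a published fact by name.  HONEST
FRAMING: BSD is not advanced; all results CONDITIONAL on the named facts; crux r2 stays OPEN.
Proofs only (no definition, no named fact, no `sorry`); helper for stmt-BirchSwinnertonDyer-19176.

References: [JetchevSkinnerWan2017] Thm. 3.3.1, §3.3 Prop. 3.3.4, §7.4.1; [KellerYin2024PotOrd]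
arXiv:2410.23241 §0.5 (the potentially multiplicative case is future work); [SilvermanATAEC1994] V.5.2–5.4.
-/

noncomputable section

open scoped Classical

namespace Summit.BirchSwinnertonDyer.BirchSwinnertonDyer.Theorems.SchneiderFreeAdditiveX3

open Field NumberField IsDedekindDomain WeierstrassCurve
  Literature.NumberTheory.EllipticCurves Literature.NumberTheory.EllipticCurves.GreenbergSelmer
  Literature.NumberTheory.GaloisRepresentations Literature.NumberTheory.GaloisCohomology
  Literature.NumberTheory.EllipticCurves.ModularForms
  Literature.NumberTheory.EllipticCurves.Rank1Residual
  Literature.NumberTheory.EllipticCurves.Rank1Residual.Typed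
  Summit.BirchSwinnertonDyer.Rank1Residual
  Summit.BirchSwinnertonDyer.Rank1Residual.X11b
  Summit.BirchSwinnertonDyer.Rank1Residual.X11b.AcSelmer
  Summit.BirchSwinnertonDyer.BirchSwinnertonDyer.Theses.SchneiderFreeAdditiveX3
  Summit.BirchSwinnertonDyer.BirchSwinnertonDyer.Theorems.SchneiderFree
  Summit.BirchSwinnertonDyer.BirchSwinnertonDyer.Theorems.SchneiderFreeControlAtoms

set_option linter.dupNamespace false

section Facts

variable
  (hPT : ∀ (K : Type) [Field K] [NumberField K], poitouTate_selmerStructure_duality K)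
  (hPT2 : ∀ (K : Type) [Field K] [NumberField K], poitouTate_sha_tateDual K)
  (hBr : ∀ (K : Type) [Field K] [NumberField K] (p : ℕ) [Fact p.Prime],
    ZpExtension.decomp_not_le_kerSubgroup_of_isAnticyclotomic K p)
  (hBrA : ∀ (K : Type) [Field K] [NumberField K] (p : ℕ) [Fact p.Prime],
    ZpExtension.decomp_not_le_kerSubgroup_above_of_isAnticyclotomic K p)
  (hKo : ∀ (N : ℕ) [NeZero N] (W : WeierstrassCurve ℚ) (K : Type) [Field K] [NumberField K],
    Literature.NumberTheory.EllipticCurves.kolyvagin N W K)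
  (hCFT : ∀ (K : Type) [Field K] [NumberField K] (p : ℕ) [Fact p.Prime],
    ZpExtension.exists_isFrobPow_mem_kerSubgroup_of_isAnticyclotomic K p)
  (hT : Silverman1994_thmV53_corV54_tateUniformisation.{0})

include hPT hPT2 hBr hBrA hKo hCFT hT in
/-- **T-B6-2′ at every (M) frame from published facts.**  For `E/ℚ` of analytic rank one, `p` odd,
`(E, p) ∈ X3 ∩ (M)`, every Heegner/parametrisation datum `(N, K, Dt, H, ι, P)` of the door and every
anticyclotomic frame `(κ, γ, 𝔭)` with `𝔭 ∣ p` of degree one: the full-index control identity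
`SchneiderFree.AdditiveControlOnTreeAt p κ 𝔭 γ (embAt K p 𝔭) P` (`X_ac` `Λ`-torsion, `f_ac(0) ≠ 0`,
`ord_p f_ac(0) = ord_p #Ш(E/K)[p^∞] + 2(ord_p log_ω P − ord_p[E(K):ℤP]) + ord_p ∏ c_w`), by door-c4's
`additiveControlOnTreeAt_anyTorsion_of_facts` with Fin_v at the frame supplied by this seat's (M) line
(`lineCharacter_subM` + `localTowerTorsionFiniteAt_of_lineCharacter`).  CONDITIONAL on the seven facts.
[cite: JetchevSkinnerWan2017, Thm. 3.3.1 and §3.3 Prop. 3.3.4 (arXiv:1512.06894 pp. 11–13)]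
[cite: SilvermanATAEC1994, Ch. V Lemma 5.2 (c), Thm. 5.3 (a),(b), Cor. 5.4 (held copy PDF pp. 406–410)] -/
theorem additiveControlOnTreeAt_subM_of_facts :
    ∀ (W : WeierstrassCurve ℚ) [W.IsElliptic] [W.IsGloballyMinimal] (p : ℕ) [Fact p.Prime],
      W.analyticRank = 1 → p ≠ 2 → ClassX3 W p → Additive.SubM W p →
      ∀ (N : ℕ) [NeZero N] (K : Type) [Field K] [NumberField K]
        (Dt : ModularParametrizationData W N) (H : HeegnerDatum N (NumberField.discr K)) (ι : K →+* ℂ)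
        (P : (W.baseChange K).toAffine.Point),
        W.analyticRank = 1 → Additive.N10.Locus W p → W.conductorNorm ℤ = N → IsImaginaryQuadratic K →
        Odd (NumberField.discr K) → ¬ p ∣ Units.torsionOrder K → SatisfiesHeegnerHypothesis N K →
        (W.quadraticTwist (NumberField.discr K : ℚ)).entireLFunction 1 ≠ 0 →
        WeierstrassCurve.Affine.Point.map ι.toRatAlgHom P = heegnerPointComplex Dt H →
        ¬ IsOfFinAddOrder P →
        ∀ (κ : ZpExtension K p), κ.IsAnticyclotomic →
          ∀ (γ : Field.absoluteGaloisGroup K) [Fact (κ.IsTopGenerator γ)]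
            (𝔭 : HeightOneSpectrum (𝓞 K)) (h𝔭 : ((p : ℕ) : 𝓞 K) ∈ 𝔭.asIdeal)
            (he : 𝔭.asIdeal.ramificationIdx (𝓞 ℚ) = 1) (hf : 𝔭.asIdeal.inertiaDeg (𝓞 ℚ) = 1),
            AdditiveControlOnTreeAt p κ 𝔭 γ (embAt K p 𝔭 h𝔭 he hf) P := by
  intro W _ _ p _ hr hp2 hX hS N _ K _ _ Dt H ι P hr' hloc hN hK hodd hunit hHe hL hP hnt κ hκ γ _ 𝔭 h𝔭 he hf
  have hS' : Additive.SubSemistableTwist W p := Or.inl hS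
  have hpN : p ∣ W.conductorNorm ℤ := dvd_conductorNorm_of_n10Locus hloc
  have hsplit : SplitsIn K p := splitsIn_of_satisfiesHeegnerHypothesis hN hHe hpN
  obtain ⟨C, a, α, hCD, hC1, hCord, hτ, hα, hchar⟩ := lineCharacter_subM hT W p hr hp2 hX hS K hK hsplit 𝔭 h𝔭
  have hFin : LocalTowerTorsionFiniteAt (W.baseChange K) p κ 𝔭 :=
    localTowerTorsionFiniteAt_of_lineCharacter W hp2 hK hsplit κ hκ 𝔭 h𝔭 (hCFT K p) C hCD hC1 hCord hτ
      a α hα hchar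
  exact additiveControlOnTreeAt_anyTorsion_of_facts hPT hPT2 hBr hBrA hKo W p hr hp2 hX hS' N K Dt H ι P
    hr' hloc hN hK hodd hunit hHe hL hP hnt κ hκ γ 𝔭 h𝔭 he hf hFin

include hPT hPT2 hBr hBrA hKo hCFT hT in
/-- **Registered stub `stub_charTorsion` of crux r2's skeleton v3 «typed halves» FROM FACTS** (signature
verbatim): at every (M) datum and frame, `X_ac(E/K_∞)` is `Λ`-torsion with a characteristic generator of
non-zero constant term (`∃ n, XAc.HasCharValuationAt … n`) — the first conjunct of T-B6-2′
(`additiveControlOnTreeAt_subM_of_facts`; gen 0 had it only from the control crux r4,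
`stub_charTorsion_of_anticycControlAdditive`).  CONDITIONAL on the seven facts.
[cite: JetchevSkinnerWan2017, Thm. 3.3.1 (arXiv:1512.06894 p. 11)] -/
theorem stub_charTorsion_of_facts :
    ∀ (W : WeierstrassCurve ℚ) [W.IsElliptic] [W.IsGloballyMinimal] (p : ℕ) [Fact p.Prime],
      W.analyticRank = 1 → p ≠ 2 → ClassX3 W p → Additive.SubM W p →
      ∀ (N : ℕ) [NeZero N] (K : Type) [Field K] [NumberField K]
        (Dt : ModularParametrizationData W N) (H : HeegnerDatum N (NumberField.discr K)) (ι : K →+* ℂ)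
        (P : (W.baseChange K).toAffine.Point),
        W.analyticRank = 1 → Additive.N10.Locus W p → W.conductorNorm ℤ = N → IsImaginaryQuadratic K →
        Odd (NumberField.discr K) → ¬ p ∣ Units.torsionOrder K → SatisfiesHeegnerHypothesis N K →
        (W.quadraticTwist (NumberField.discr K : ℚ)).entireLFunction 1 ≠ 0 →
        WeierstrassCurve.Affine.Point.map ι.toRatAlgHom P = heegnerPointComplex Dt H →
        ¬ IsOfFinAddOrder P →
        ∀ (κ : ZpExtension K p), κ.IsAnticyclotomic →
          ∀ (γ : Field.absoluteGaloisGroup K) [Fact (κ.IsTopGenerator γ)]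
            (𝔭 : HeightOneSpectrum (𝓞 K)) (h𝔭 : ((p : ℕ) : 𝓞 K) ∈ 𝔭.asIdeal)
            (he : 𝔭.asIdeal.ramificationIdx (𝓞 ℚ) = 1) (hf : 𝔭.asIdeal.inertiaDeg (𝓞 ℚ) = 1),
            ∃ n : ℕ, XAc.HasCharValuationAt (W.baseChange K) p κ 𝔭 ∅ γ n := by
  intro W _ _ p _ hr hp2 hX hS N _ K _ _ Dt H ι P hr' hloc hN hK hodd hunit hHe hL hP hnt κ hκ γ _ 𝔭 h𝔭 he hf
  exact exists_hasCharValuationAt_of_control (additiveControlOnTreeAt_subM_of_facts hPT hPT2 hBr hBrA hKo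
    hCFT hT W p hr hp2 hX hS N K Dt H ι P hr' hloc hN hK hodd hunit hHe hL hP hnt κ hκ γ 𝔭 h𝔭 he hf)

include hPT hPT2 hBr hBrA hKo hCFT hT in
/-- **Crux r2 `PotMultBranchIMC` from the seven published facts and its pure-divisibility half** — the
REGISTERED stub `stub_divisibilityLe` (signature verbatim as the last hypothesis: at every (M) frame,
for every `n` with `XAc.HasCharValuationAt … n`, `2·ord_p log_ω P ≤ n + 2·v_p(Dt.c)` — the door
direction `𝓛^{BDP} ∣ char Λ X_ac` at 𝟙 with LZZ18's value; NONE IN PRINT).  The control crux r4 is no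
longer an input on the (M) cell. [cite: KellerYin2024PotOrd, arXiv:2410.23241 §0.5 (the potentially multiplicative case is not treated)]
[cite: JetchevSkinnerWan2017, Thm. 3.3.1 and §7.4.1 (arXiv:1512.06894 pp. 11, 30)] -/
theorem potMultBranchIMC_of_facts_of_divisibilityLe
    (hdiv :
    ∀ (W : WeierstrassCurve ℚ) [W.IsElliptic] [W.IsGloballyMinimal] (p : ℕ) [Fact p.Prime],
      W.analyticRank = 1 → p ≠ 2 → ClassX3 W p → Additive.SubM W p →
      ∀ (N : ℕ) [NeZero N] (K : Type) [Field K] [NumberField K]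
        (Dt : ModularParametrizationData W N) (H : HeegnerDatum N (NumberField.discr K)) (ι : K →+* ℂ)
        (P : (W.baseChange K).toAffine.Point),
        W.analyticRank = 1 → Additive.N10.Locus W p → W.conductorNorm ℤ = N → IsImaginaryQuadratic K →
        Odd (NumberField.discr K) → ¬ p ∣ Units.torsionOrder K → SatisfiesHeegnerHypothesis N K →
        (W.quadraticTwist (NumberField.discr K : ℚ)).entireLFunction 1 ≠ 0 →
        WeierstrassCurve.Affine.Point.map ι.toRatAlgHom P = heegnerPointComplex Dt H →
        ¬ IsOfFinAddOrder P →
        ∀ (κ : ZpExtension K p), κ.IsAnticyclotomic →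
          ∀ (γ : Field.absoluteGaloisGroup K) [Fact (κ.IsTopGenerator γ)]
            (𝔭 : HeightOneSpectrum (𝓞 K)) (h𝔭 : ((p : ℕ) : 𝓞 K) ∈ 𝔭.asIdeal)
            (he : 𝔭.asIdeal.ramificationIdx (𝓞 ℚ) = 1) (hf : 𝔭.asIdeal.inertiaDeg (𝓞 ℚ) = 1),
            ∀ n : ℕ, XAc.HasCharValuationAt (W.baseChange K) p κ 𝔭 ∅ γ n →
              2 * X11b.padicLogOrd W p (embAt K p 𝔭 h𝔭 he hf) P ≤
                (n : ℤ) + 2 * (padicValNat p Dt.c.natAbs : ℤ)) :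
    PotMultBranchIMC := by
  intro W _ _ p _ hr hp2 hX hS N _ K _ _ Dt H ι P hr' hloc hN hK hodd hunit hHe hL hP hnt κ hκ γ _ 𝔭 h𝔭 he hf
  obtain ⟨n, hn⟩ := stub_charTorsion_of_facts hPT hPT2 hBr hBrA hKo hCFT hT W p hr hp2 hX hS N K Dt H ι P
    hr' hloc hN hK hodd hunit hHe hL hP hnt κ hκ γ 𝔭 h𝔭 he hf
  exact ⟨n, hn, hdiv W p hr hp2 hX hS N K Dt H ι P hr' hloc hN hK hodd hunit hHe hL hP hnt κ hκ γ 𝔭 h𝔭 he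
    hf n hn⟩

include hPT hPT2 hBr hBrA hKo hCFT hT in
/-- **Crux r2 ⟺ its pure-divisibility half, MODULO PUBLISHED FACTS ONLY** (gen 4's
`potMultBranchIMC_iff_divisibilityLe_of_anticycControlAdditiveK{,F}` with the control crux r4 and its
Fin_v input DISCHARGED on the (M) cell): `PotMultBranchIMC` holds iff the registered stub
`stub_divisibilityLe` does — forward unconditionally (`potMult_divisibilityLe_of_potMultBranchIMC`,
`HasCharValuationAt.unique`), backward by `potMultBranchIMC_of_facts_of_divisibilityLe`.  The typed
re-statement of item 19176 for the planner: its open content on the (M) cell is the divisibility alone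
(layer 2: H1|M/H2|M/H3|M of `SchneiderFreeAdditiveX3Defs`), every other input a published fact by name.
[cite: KellerYin2024PotOrd, arXiv:2410.23241 §0.5 (the potentially multiplicative case is not treated)]
[cite: JetchevSkinnerWan2017, Thm. 3.3.1 and §7.4.1 (arXiv:1512.06894 pp. 11, 30)] -/
theorem potMultBranchIMC_iff_divisibilityLe_of_facts :
    PotMultBranchIMC ↔
    ∀ (W : WeierstrassCurve ℚ) [W.IsElliptic] [W.IsGloballyMinimal] (p : ℕ) [Fact p.Prime],
      W.analyticRank = 1 → p ≠ 2 → ClassX3 W p → Additive.SubM W p →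
      ∀ (N : ℕ) [NeZero N] (K : Type) [Field K] [NumberField K]
        (Dt : ModularParametrizationData W N) (H : HeegnerDatum N (NumberField.discr K)) (ι : K →+* ℂ)
        (P : (W.baseChange K).toAffine.Point),
        W.analyticRank = 1 → Additive.N10.Locus W p → W.conductorNorm ℤ = N → IsImaginaryQuadratic K →
        Odd (NumberField.discr K) → ¬ p ∣ Units.torsionOrder K → SatisfiesHeegnerHypothesis N K →
        (W.quadraticTwist (NumberField.discr K : ℚ)).entireLFunction 1 ≠ 0 →
        WeierstrassCurve.Affine.Point.map ι.toRatAlgHom P = heegnerPointComplex Dt H →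
        ¬ IsOfFinAddOrder P →
        ∀ (κ : ZpExtension K p), κ.IsAnticyclotomic →
          ∀ (γ : Field.absoluteGaloisGroup K) [Fact (κ.IsTopGenerator γ)]
            (𝔭 : HeightOneSpectrum (𝓞 K)) (h𝔭 : ((p : ℕ) : 𝓞 K) ∈ 𝔭.asIdeal)
            (he : 𝔭.asIdeal.ramificationIdx (𝓞 ℚ) = 1) (hf : 𝔭.asIdeal.inertiaDeg (𝓞 ℚ) = 1),
            ∀ n : ℕ, XAc.HasCharValuationAt (W.baseChange K) p κ 𝔭 ∅ γ n →
              2 * X11b.padicLogOrd W p (embAt K p 𝔭 h𝔭 he hf) P ≤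
                (n : ℤ) + 2 * (padicValNat p Dt.c.natAbs : ℤ) :=
  ⟨potMult_divisibilityLe_of_potMultBranchIMC,
    potMultBranchIMC_of_facts_of_divisibilityLe hPT hPT2 hBr hBrA hKo hCFT hT⟩

end Facts

/-! ## Appendix (gen 5): crux r2 from the published facts and the three TYPED HALVES -/

section TypedHalves

/-- **Crux r2 `PotMultBranchIMC` from the seven published facts and the three typed halves H1|M, H2|M,
H3|M** (`BranchBDPExistsAt` / `BranchBDPValueLeAt` / `BranchIMCDivAt` of `SchneiderFreeAdditiveX3Defs` on
`Additive.SubM` — the stubs `stub_bdpExistsSubM` / `stub_bdpValueLeSubM` / `stub_imcDivSubM` of skeleton v3):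
door-c3 gen 2's `potMult_stub_divisibilityLe_of_typedHalves` gives the divisibility half, and
`potMultBranchIMC_of_facts_of_divisibilityLe` the crux.  This is the COMPOSITION of a three-stub
skeleton for item 19176 whose non-stub hypotheses are published facts only (no control crux, no
`stub_charTorsion`).  CONDITIONAL; the three halves are NOT in print on (M).
[cite: KellerYin2024PotOrd, arXiv:2410.23241 §0.5 (the potentially multiplicative case is not treated)]
[cite: Castella2018, Thm. 2.3 and §5 (5.1) (arXiv:1704.06608 pp. 5, 12) (shape only)] -/
theorem potMultBranchIMC_of_facts_of_typedHalves
    (hPT : ∀ (K : Type) [Field K] [NumberField K], poitouTate_selmerStructure_duality K)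
    (hPT2 : ∀ (K : Type) [Field K] [NumberField K], poitouTate_sha_tateDual K)
    (hBr : ∀ (K : Type) [Field K] [NumberField K] (p : ℕ) [Fact p.Prime],
      ZpExtension.decomp_not_le_kerSubgroup_of_isAnticyclotomic K p)
    (hBrA : ∀ (K : Type) [Field K] [NumberField K] (p : ℕ) [Fact p.Prime],
      ZpExtension.decomp_not_le_kerSubgroup_above_of_isAnticyclotomic K p)
    (hKo : ∀ (N : ℕ) [NeZero N] (W : WeierstrassCurve ℚ) (K : Type) [Field K] [NumberField K],
      Literature.NumberTheory.EllipticCurves.kolyvagin N W K)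
    (hCFT : ∀ (K : Type) [Field K] [NumberField K] (p : ℕ) [Fact p.Prime],
      ZpExtension.exists_isFrobPow_mem_kerSubgroup_of_isAnticyclotomic K p)
    (hT : Silverman1994_thmV53_corV54_tateUniformisation.{0})
    (h1 : ∀ (W : WeierstrassCurve ℚ) [W.IsElliptic] [W.IsGloballyMinimal] (p : ℕ) [Fact p.Prime],
      W.analyticRank = 1 → p ≠ 2 → ClassX3 W p → Additive.SubM W p → BranchBDPExistsAt W p)
    (h2 : ∀ (W : WeierstrassCurve ℚ) [W.IsElliptic] [W.IsGloballyMinimal] (p : ℕ) [Fact p.Prime],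
      W.analyticRank = 1 → p ≠ 2 → ClassX3 W p → Additive.SubM W p → BranchBDPValueLeAt W p)
    (h3 : ∀ (W : WeierstrassCurve ℚ) [W.IsElliptic] [W.IsGloballyMinimal] (p : ℕ) [Fact p.Prime],
      W.analyticRank = 1 → p ≠ 2 → ClassX3 W p → Additive.SubM W p → BranchIMCDivAt W p) :
    PotMultBranchIMC :=
  potMultBranchIMC_of_facts_of_divisibilityLe hPT hPT2 hBr hBrA hKo hCFT hT
    (potMult_stub_divisibilityLe_of_typedHalves h1 h2 h3)

end TypedHalves

end Summit.BirchSwinnertonDyer.BirchSwinnertonDyer.Theorems.SchneiderFreeAdditiveX3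

end
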